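import Summits.BirchSwinnertonDyer.BirchSwinnertonDyer.Theorems.TangentConeEdgeDecayStubTwoVarDominant
import Summits.BirchSwinnertonDyer.BirchSwinnertonDyer.Theorems.TangentConeEdgeDecayStubTwoVarEvalNormLe
import Summits.BirchSwinnertonDyer.BirchSwinnertonDyer.Theorems.TangentConeEdgeDecayStubLowestFormNonvanishing
import Summits.BirchSwinnertonDyer.BirchSwinnertonDyer.Theorems.TangentConeEdgeDecayStubNormCycPow
import HarnessLib

/-!
# BirchSwinnertonDyer / TangentCone — crux `EdgeDecay` (stmt-BirchSwinnertonDyer-17608), line `lambda-layer-one`: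
# stub `stub_twoVarRateOfOrder` — a bounded two-variable series with a non-zero coefficient of degree `≤ n` on
# the axis `X = 0` decays at rate `≤ n` along a lattice curve

Registered stub of the skeleton `Cruxes/EdgeDecay/Lines/lambda_layer_one.lean` (lead
`prover-line-stmt-BirchSwinnertonDyer-17608-0`). This is the whole ANALYTIC content of the XL stub
`stub_gsTotalDecayLeCycOrder` ("two-variable total decay `≤` cyclotomic order", shared with line
`ub_schneider_squeeze`), separated from the modular-forms bookkeeping: if `F = Σ F_ij X^i Y^j` has
coefficients bounded by `M` in `ℚ_p` and `F_{0,j₀} ≠ 0` for some `j₀ ≤ n` (i.e. `ord_Y F(0,Y) ≤ n`), then there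
are a lattice slope `a/b < 1/2` and constants `m₀, C` such that for every `t > 0` with `v_p(t) ≥ m₀`, at the
point `x = γ^{tb} - 1`, `y_s = γ^{ta} - 1` (`γ = 1 + p`), every real `r ≥ 0` tying a second value `F(x, y)`,
`‖y‖ < 1`, to `F(x, y_s)` by `r · ‖F(x,y)‖ = ‖F(x,y_s)‖` satisfies `r · p^{n (v_p(t)+1) + C} ≥ 1`.
In the crux, `r = ‖ι(Λ(g_k,s)/Λ(g_k,j))‖` is the edge ratio of the weight-`k = 2 + tb` branch member and the
tying identity is the Greenberg–Stevens/Kitagawa ratio interpolation.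

Proof: total order `d ≤ n` of `F` (least `i+j` with `F_ij ≠ 0`); `stub_lowestFormNonvanishing` gives `(b,a)`,
`0 < b`, `2a < b`, off the zeros of the lowest form `F_d`; `stub_twoVarDominant` gives `m₀` with
`‖F((1+z)^b-1,(1+z)^a-1)‖ = ‖F_d(b,a)‖ ‖z‖^d` for `0 < ‖z‖ ≤ p^{-m₀-1}`; with `z = γ^t - 1`,
`‖z‖ = p^{-1-v_p(t)}` (`stub_normCycPow`), `(1+z)^b - 1 = x`, `(1+z)^a - 1 = y_s`, so
`‖F(x,y_s)‖ ≥ ‖F_d(b,a)‖ p^{-n(v_p(t)+1)}`, while `‖F(x,y)‖ ≤ M` (`stub_twoVarEvalNormLe`); choose `C` with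
`p^C ≥ M/‖F_d(b,a)‖`.
-/

set_option linter.dupNamespace false

namespace Summit.BirchSwinnertonDyer.BirchSwinnertonDyer.Theorems

open scoped Classical
open Filter Topology

/-- **Rate `≤ n` from a non-zero coefficient of degree `≤ n` on the axis** (elementary `p`-adic analysis; the
analytic half of Greenberg–Stevens' "total order ≤ order of the restriction to the cyclotomic line", in the form
consumed by crux `EdgeDecay`): see the module docstring. [folklore] -/
theorem stub_twoVarRateOfOrder :
    ∀ (p : ℕ) [Fact p.Prime], p ≠ 2 → ∀ (F : ℕ → ℕ → ℚ_[p]) (M : ℝ) (n : ℕ), (∀ i j : ℕ, ‖F i j‖ ≤ M) → (∃ j : ℕ, j ≤ n ∧ F 0 j ≠ 0) → ∃ a b : ℕ, 0 < b ∧ 2 * a < b ∧ ∃ m₀ C : ℕ, ∀ t : ℕ, 0 < t → m₀ ≤ padicValNat p t → ∀ (y : ℚ_[p]) (r : ℝ), ‖y‖ < 1 → 0 ≤ r → r * ‖∑' q : ℕ × ℕ, F q.1 q.2 * (((1 + p : ℕ) : ℚ_[p]) ^ (t * b) - 1) ^ q.1 * (y) ^ q.2‖ = ‖∑' q : ℕ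 × ℕ, F q.1 q.2 * (((1 + p : ℕ) : ℚ_[p]) ^ (t * b) - 1) ^ q.1 * (((1 + p : ℕ) : ℚ_[p]) ^ (t * a) - 1) ^ q.2‖ → 1 ≤ r * (p : ℝ) ^ (n * (padicValNat p t + 1) + C) := by
  intro p _ hp2 F M n hFM hj
  classical
  have hp : p.Prime := Fact.out
  have hp1 : (1 : ℝ) < p := by exact_mod_cast hp.one_lt
  set γ : ℚ_[p] := ((1 + p : ℕ) : ℚ_[p]) with hγ
  obtain ⟨j₀, hj₀n, hF0j⟩ := hj
  -- the total order `d ≤ n` of `F`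
  have hex : ∃ e : ℕ, ∃ i j : ℕ, i + j = e ∧ F i j ≠ 0 := ⟨j₀, 0, j₀, by simp, hF0j⟩
  obtain ⟨i₁, j₁, hij₁, hF₁⟩ : ∃ i j : ℕ, i + j = Nat.find hex ∧ F i j ≠ 0 := Nat.find_spec hex
  set d : ℕ := Nat.find hex with hd
  have hdn : d ≤ n := (Nat.find_min' hex ⟨0, j₀, by simp, hF0j⟩).trans hj₀n
  have hlow : ∀ i j : ℕ, i + j < d → F i j = 0 := by
    intro i j hij
    by_contra hne
    exact Nat.find_min hex hij ⟨i, j, rfl, hne⟩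
  -- a lattice slope `a/b < 1/2` off the zeros of the lowest form
  obtain ⟨a, b, hb, hab, hFd⟩ := stub_lowestFormNonvanishing p (fun j => F (d - j) j) d
    ⟨j₁, by omega, by show F (d - j₁) j₁ ≠ 0; rw [show d - j₁ = i₁ by omega]; exact hF₁⟩
  -- dominant term
  obtain ⟨m₀, hdom⟩ := stub_twoVarDominant p F M d a b hFM hlow hFd
  set c₀ : ℝ := ‖∑ j ∈ Finset.range (d + 1), F (d - j) j * (b : ℚ_[p]) ^ (d - j) * (a : ℚ_[p]) ^ j‖
    with hc₀
  have hc₀pos : 0 < c₀ := norm_pos_iff.mpr hFd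
  have hMpos : 0 < M := lt_of_lt_of_le (norm_pos_iff.mpr hF0j) (hFM 0 j₀)
  obtain ⟨C₁, hC₁⟩ : ∃ C₁ : ℕ, M / c₀ ≤ (p : ℝ) ^ C₁ := by
    obtain ⟨C₁, hC₁⟩ := pow_unbounded_of_one_lt (M / c₀) hp1
    exact ⟨C₁, hC₁.le⟩
  refine ⟨a, b, hb, hab, m₀, C₁, fun t htpos hvt y r hy hr hnorm => ?_⟩
  -- the parameter `z = γ^t - 1`
  set v : ℕ := padicValNat p t with hv
  set z : ℚ_[p] := γ ^ t - 1 with hz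
  have hxz : (1 + z) ^ b - 1 = γ ^ (t * b) - 1 := by
    rw [hz, add_sub_cancel, ← pow_mul]
  have hyz : (1 + z) ^ a - 1 = γ ^ (t * a) - 1 := by
    rw [hz, add_sub_cancel, ← pow_mul]
  have hnz : ‖z‖ = ((p : ℝ) ^ (v + 1))⁻¹ := by
    rw [hz, hγ, stub_normCycPow p hp2 t htpos, ← hv, ← zpow_natCast, ← zpow_neg]
    congr 1
    push_cast
    ring
  have hz0 : z ≠ 0 := by
    rw [← norm_pos_iff, hnz]; positivity
  have hzle : ‖z‖ ≤ (p : ℝ) ^ (-(m₀ : ℤ) - 1) := by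
    rw [hnz, ← zpow_natCast, ← zpow_neg]
    apply zpow_le_zpow_right₀ hp1.le
    push_cast
    omega
  have hz1 : ‖z‖ ≤ 1 := by
    rw [hnz]; exact inv_le_one_of_one_le₀ (one_le_pow₀ hp1.le)
  have hdz := hdom z hz0 hzle
  rw [hxz, hyz] at hdz
  -- evaluation bound at `(x, y)`
  have hxlt : ‖γ ^ (t * b) - 1‖ < 1 := by
    rw [hγ, stub_normCycPow p hp2 (t * b) (Nat.mul_pos htpos hb)]
    calc (p : ℝ) ^ (-(padicValNat p (t * b) : ℤ) - 1) ≤ (p : ℝ) ^ (-1 : ℤ) :=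
          zpow_le_zpow_right₀ hp1.le (by omega)
      _ < 1 := zpow_lt_one_of_neg₀ hp1 (by norm_num)
  obtain ⟨-, hev⟩ := stub_twoVarEvalNormLe p F M (γ ^ (t * b) - 1) y hFM hxlt hy
  -- bookkeeping in `ℝ`
  have hzn : ‖z‖ ^ n * (p : ℝ) ^ (n * (v + 1)) = 1 := by
    rw [hnz, inv_pow, ← pow_mul, mul_comm (v + 1) n, inv_mul_cancel₀]
    positivity
  have hzdn : ‖z‖ ^ n ≤ ‖z‖ ^ d := pow_le_pow_of_le_one (norm_nonneg _) hz1 hdn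
  have h1 : c₀ * ‖z‖ ^ n ≤ r * M := by
    calc c₀ * ‖z‖ ^ n ≤ c₀ * ‖z‖ ^ d := mul_le_mul_of_nonneg_left hzdn hc₀pos.le
      _ = _ := hdz.symm
      _ = _ := hnorm.symm
      _ ≤ r * M := mul_le_mul_of_nonneg_left hev hr
  have h2 : c₀ ≤ r * M * (p : ℝ) ^ (n * (v + 1)) := by
    calc c₀ = c₀ * ‖z‖ ^ n * (p : ℝ) ^ (n * (v + 1)) := by rw [mul_assoc, hzn, mul_one]
      _ ≤ r * M * (p : ℝ) ^ (n * (v + 1)) := mul_le_mul_of_nonneg_right h1 (by positivity)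
  rw [pow_add]
  have h5 : 1 ≤ r * (p : ℝ) ^ (n * (v + 1)) * (M / c₀) := by
    rw [show r * (p : ℝ) ^ (n * (v + 1)) * (M / c₀) = (r * M * (p : ℝ) ^ (n * (v + 1))) / c₀ by ring]
    rw [le_div_iff₀ hc₀pos, one_mul]
    exact h2
  calc (1 : ℝ) ≤ r * (p : ℝ) ^ (n * (v + 1)) * (M / c₀) := h5
    _ ≤ r * (p : ℝ) ^ (n * (v + 1)) * (p : ℝ) ^ C₁ := mul_le_mul_of_nonneg_left hC₁ (by positivity)
    _ = r * ((p : ℝ) ^ (n * (v + 1)) * (p : ℝ) ^ C₁) := by ring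

end Summit.BirchSwinnertonDyer.BirchSwinnertonDyer.Theorems
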